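import Summits.AtomisticToContinuum.BoseEinsteinCondensation.Theorems.BECConjugateDominationHardCoreExtensionPairShellMassTransfer
import Summits.AtomisticToContinuum.BoseEinsteinCondensation.Theorems.BECConjugateDominationHardCoreExtensionPairShellMassAnnulus
import HarnessLib

/-!
# Outer pair-shell mass of a periodic `C¹` function (line `third-law-current-floor`, crux
# `HardCoreExtension`, stmt-AtomisticToContinuum-11786; node P4 of the (α') plan): `stub_pairShellMassBoundV2`

For `N` particles on the torus of side `L > 4a > 0` and a shell width `0 < ℓ ≤ a`, every periodic `C¹`
function `Ψ : (ℝ³)^N → ℂ` satisfies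

  `∫_{S_O ∩ cell} |Ψ|² ≤ C ∫_{S_I ∩ cell} |Ψ|² + C ℓ² ∫_{S_F ∩ cell} |∇Ψ|²`,   `C = 16 N²`,

where `S_O = {∃ i ≠ j ∃ n ∈ ℤ³, a < |xᵢ - xⱼ - Ln| < a + ℓ}` is the OUTER pair shell, `S_I` the INNER layer
`a - ℓ < |xᵢ - xⱼ - Ln| ≤ a` and `S_F` the two-sided layer `a - ℓ < |xᵢ - xⱼ - Ln| < a + ℓ`. In the
`C¹`-cutoff scheme for the hard-core energy convergence (α') this makes the cut-off error `ℓ⁻² ∫_{S_O}|Ψₙ|²`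
small: the inner layer lies inside the core (mass `≤ E/n` for a truncation minimiser) and the layer kinetic
energy is small by kinetic tightness.

Proof (no trace theorem, no polar coordinates; the lemmas are in the two support files
`BECConjugateDominationHardCoreExtensionPairShellMassTransfer.lean` (lattice bookkeeping, unfolding, transfer
to the cell; registered sub-goal `stub_pairShellMassTransfer`) and
`BECConjugateDominationHardCoreExtensionPairShellMassAnnulus.lean` (scaling, segment bound, annulus estimate;
registered sub-goal `stub_pairShellMassAnnulus`)). Fix an ordered pair `i ≠ j` and the set weights
`w_S(X) = ∑ₙ 1_S(xᵢ - xⱼ - Ln)`, `S ∈ {O, I, F} ⊂ ℝ³` the three annuli.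
* UNFOLDING (`PairShellMass.setLIntegral_cell_latSum_mul`, from the tiling lemma
  `lintegral_mul_eq_lintegral_mul_indicator_latSum`): for `G ≥ 0` periodic in `xᵢ`,
  `∫_{xᵢ ∈ cell} w_S G = ∫_{y ∈ S} G(xᵢ := xⱼ + y) dy`; the other particles are integrated out by
  `MeasureTheory.lintegral_le_of_lmarginal_le` (`PairShellMass.pair_transfer`).
* PAIR VARIABLE (`PairShellMass.annulus_sq_le`): with `c = a/(a+ℓ) ∈ [1/2, 1)`, `cO ⊂ I`, pointwise
  `|Φ(y)|² ≤ 2|Φ(cy)|² + 2|Φ(y) - Φ(cy)|²`; the first term is moved to `I` by the linear change of variables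
  `z = cy` (Jacobian `c⁻³ ≤ 8`, `MeasureTheory.Measure.map_addHaar_smul`); the second is bounded by the
  fundamental theorem of calculus along the segment `[cy, y]` and Cauchy–Schwarz
  (`PairShellMass.nnnorm_sub_sq_le`: `|Ψ(Z + eᵢ⊗r) - Ψ(Z)|² ≤ |r|² ∫₀¹ |∇Ψ|²(Z + t eᵢ⊗r) dt`, `|r| ≤ ℓ` on `O`),
  Tonelli, and the same change of variables at the intermediate scales `c + t(1-c) ∈ [1/2, 1]`, which map
  `O` into `F`. This gives `∫_O |Φ|² ≤ 16 ∫_I |Φ|² + 16 ℓ² ∫_F |∇Ψ|²` fibrewise.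
* SUMMING over ordered pairs: `1_{S_O} ≤ ∑_{i≠j} w_O`, while `w_I ≤ 1_{S_I}`, `w_F ≤ 1_{S_F}` because two
  lattice translates of a ball of radius `2a < L/2` are disjoint (`PairShellMass.tsum_indicator_sub_latticeVec_le`).
All [folklore]; no named fact is used.

`stub_pairShellMassBoundV2` is the correctly parenthesised re-registration of `stub_pairShellMassBound`: in the
latter the `∫⁻ X in s, body` notation swallowed the `+ ENNReal.ofReal (C * ℓ ^ 2) * ∫⁻ …` term into the body of
the first integral, which turns the right-hand side into `C (mass_I + C ℓ² · kin_F · vol(S_I ∩ cell))`, an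
`O(ℓ³)`-type bound that fails for `N ≥ 2` (a fixed `Ψ` vanishing to second order at the wall has outer mass
`~ ℓ⁵` against `~ ℓ⁶`). Here every product `c * (∫⁻ …)` followed by `+` is parenthesised.
-/

noncomputable section

namespace Summit.AtomisticToContinuum.BoseEinsteinCondensation.Cruxes.HardCoreExtension.ThirdLawCurrentFloor

open MeasureTheory Filter
open scoped ENNReal NNReal BigOperators Topology
open Literature.MathematicalPhysics.QuantumManyBody.BoseGas

namespace PairShellMass

variable {N : ℕ} {L : ℝ}

/-! ### The estimate -/

/-- **Outer pair-shell mass bound** (the statement of `stub_pairShellMassBoundV2` with the explicit constant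
`C = 16 N²`). [folklore] -/
theorem shell_estimate (hL : 0 < L) {a ℓ : ℝ} (ha : 0 < a) (h4a : 4 * a < L) (hℓ : 0 < ℓ)
    (hℓa : ℓ ≤ a) {Ψ : Config N → ℂ} (hΨ : ContDiff ℝ 1 Ψ)
    (hper : ∀ (X : Config N) (i : Fin N) (k : Fin 3),
      Ψ (X + Pi.single i (EuclideanSpace.single k L)) = Ψ X) :
    ∫⁻ X in {X : Config N | ∃ i j : Fin N, i ≠ j ∧ ∃ n : Fin 3 → ℤ,
        a < ‖X i - X j - latticeVec L n‖ ∧ ‖X i - X j - latticeVec L n‖ < a + ℓ} ∩ cellN N L,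
        (‖Ψ X‖₊ : ℝ≥0∞) ^ 2 ≤
      ENNReal.ofReal ((16 * N ^ 2 : ℕ) : ℝ) *
          (∫⁻ X in {X : Config N | ∃ i j : Fin N, i ≠ j ∧ ∃ n : Fin 3 → ℤ,
              a - ℓ < ‖X i - X j - latticeVec L n‖ ∧ ‖X i - X j - latticeVec L n‖ ≤ a} ∩ cellN N L,
              (‖Ψ X‖₊ : ℝ≥0∞) ^ 2) +
        ENNReal.ofReal (((16 * N ^ 2 : ℕ) : ℝ) * ℓ ^ 2) *
          (∫⁻ X in {X : Config N | ∃ i j : Fin N, i ≠ j ∧ ∃ n : Fin 3 → ℤ,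
              a - ℓ < ‖X i - X j - latticeVec L n‖ ∧ ‖X i - X j - latticeVec L n‖ < a + ℓ} ∩ cellN N L,
              kineticDensity Ψ X) := by
  set O : Set Space := {y : Space | a < ‖y‖ ∧ ‖y‖ < a + ℓ}
  set I : Set Space := {y : Space | a - ℓ < ‖y‖ ∧ ‖y‖ ≤ a}
  set F : Set Space := {y : Space | a - ℓ < ‖y‖ ∧ ‖y‖ < a + ℓ}
  set SO : Set (Config N) := {X : Config N | ∃ i j : Fin N, i ≠ j ∧ ∃ n : Fin 3 → ℤ,
    a < ‖X i - X j - latticeVec L n‖ ∧ ‖X i - X j - latticeVec L n‖ < a + ℓ}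
  set SI : Set (Config N) := {X : Config N | ∃ i j : Fin N, i ≠ j ∧ ∃ n : Fin 3 → ℤ,
    a - ℓ < ‖X i - X j - latticeVec L n‖ ∧ ‖X i - X j - latticeVec L n‖ ≤ a}
  set SF : Set (Config N) := {X : Config N | ∃ i j : Fin N, i ≠ j ∧ ∃ n : Fin 3 → ℤ,
    a - ℓ < ‖X i - X j - latticeVec L n‖ ∧ ‖X i - X j - latticeVec L n‖ < a + ℓ}
  set 𝓐 := ∫⁻ X in SI ∩ cellN N L, (‖Ψ X‖₊ : ℝ≥0∞) ^ 2 with h𝓐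
  set 𝓑 := ∫⁻ X in SF ∩ cellN N L, kineticDensity Ψ X with h𝓑
  -- measurability
  have hOm : MeasurableSet O := measurableSet_annulus_oo a (a + ℓ)
  have hIm : MeasurableSet I := measurableSet_annulus_oc (a - ℓ) a
  have hFm : MeasurableSet F := measurableSet_annulus_oo (a - ℓ) (a + ℓ)
  have hSOm : MeasurableSet SO := measurableSet_pairSet N L hOm
  have hSIm : MeasurableSet SI := measurableSet_pairSet N L hIm
  have hSFm : MeasurableSet SF := measurableSet_pairSet N L hFm
  have hf : Measurable fun X : Config N ↦ ((‖Ψ X‖₊ : ℝ≥0∞) ^ 2) :=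
    hΨ.continuous.measurable.nnnorm.coe_nnreal_ennreal.pow_const 2
  have hkin : Measurable (kineticDensity Ψ) := measurable_kineticDensity hΨ
  -- lattice invariance of `|Ψ|²` and `|∇Ψ|²`
  have hΨlat : ∀ (X : Config N) (i : Fin N) (n : Fin 3 → ℤ),
      Ψ (X - Pi.single i (latticeVec L n)) = Ψ X := apply_sub_single_latticeVec hper
  have hKlat : ∀ (X : Config N) (i : Fin N) (n : Fin 3 → ℤ),
      kineticDensity Ψ (X - Pi.single i (latticeVec L n)) = kineticDensity Ψ X :=
    apply_sub_single_latticeVec (kineticDensity_add_single_of_periodic hper)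
  -- (1) the outer shell is covered by the ordered-pair weights
  have h1 : ∫⁻ X in SO ∩ cellN N L, (‖Ψ X‖₊ : ℝ≥0∞) ^ 2 ≤
      ∑ i : Fin N, ∑ j ∈ Finset.univ.erase i, ∫⁻ X in cellN N L,
        (∑' n : Fin 3 → ℤ, O.indicator (1 : Space → ℝ≥0∞) (X i - X j - latticeVec L n)) *
          (‖Ψ X‖₊ : ℝ≥0∞) ^ 2 := by
    rw [← Measure.restrict_restrict hSOm, ← lintegral_indicator hSOm]
    have hpt : ∀ X : Config N, SO.indicator (fun X ↦ ((‖Ψ X‖₊ : ℝ≥0∞) ^ 2)) X ≤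
        ∑ i : Fin N, ∑ j ∈ Finset.univ.erase i,
          (∑' n : Fin 3 → ℤ, O.indicator (1 : Space → ℝ≥0∞) (X i - X j - latticeVec L n)) *
            (‖Ψ X‖₊ : ℝ≥0∞) ^ 2 := by
      intro X
      by_cases hX : X ∈ SO
      · rw [Set.indicator_of_mem hX]
        obtain ⟨i, j, hij, n, hn⟩ := hX
        calc ((‖Ψ X‖₊ : ℝ≥0∞) ^ 2) = 1 * ((‖Ψ X‖₊ : ℝ≥0∞) ^ 2) := (one_mul _).symm
          _ ≤ (∑' m : Fin 3 → ℤ, O.indicator (1 : Space → ℝ≥0∞) (X i - X j - latticeVec L m)) *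
                ((‖Ψ X‖₊ : ℝ≥0∞) ^ 2) := by
              refine mul_le_mul_left ?_ _
              calc (1 : ℝ≥0∞) = O.indicator (1 : Space → ℝ≥0∞) (X i - X j - latticeVec L n) := by
                    rw [Set.indicator_of_mem (show X i - X j - latticeVec L n ∈ O from hn), Pi.one_apply]
                _ ≤ ∑' m : Fin 3 → ℤ, O.indicator (1 : Space → ℝ≥0∞) (X i - X j - latticeVec L m) :=
                    ENNReal.le_tsum n
          _ ≤ ∑ j' ∈ Finset.univ.erase i,
                (∑' m : Fin 3 → ℤ, O.indicator (1 : Space → ℝ≥0∞) (X i - X j' - latticeVec L m)) *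
                  ((‖Ψ X‖₊ : ℝ≥0∞) ^ 2) :=
              Finset.single_le_sum (f := fun j' ↦
                (∑' m : Fin 3 → ℤ, O.indicator (1 : Space → ℝ≥0∞) (X i - X j' - latticeVec L m)) *
                  ((‖Ψ X‖₊ : ℝ≥0∞) ^ 2)) (fun _ _ ↦ zero_le)
                (Finset.mem_erase.2 ⟨hij.symm, Finset.mem_univ j⟩)
          _ ≤ ∑ i' : Fin N, ∑ j' ∈ Finset.univ.erase i',
                (∑' m : Fin 3 → ℤ, O.indicator (1 : Space → ℝ≥0∞) (X i' - X j' - latticeVec L m)) *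
                  ((‖Ψ X‖₊ : ℝ≥0∞) ^ 2) :=
              Finset.single_le_sum (f := fun i' ↦ ∑ j' ∈ Finset.univ.erase i',
                (∑' m : Fin 3 → ℤ, O.indicator (1 : Space → ℝ≥0∞) (X i' - X j' - latticeVec L m)) *
                  ((‖Ψ X‖₊ : ℝ≥0∞) ^ 2)) (fun _ _ ↦ zero_le) (Finset.mem_univ i)
      · rw [Set.indicator_of_notMem hX]
        exact zero_le
    calc ∫⁻ X in cellN N L, SO.indicator (fun X ↦ ((‖Ψ X‖₊ : ℝ≥0∞) ^ 2)) X
        ≤ ∫⁻ X in cellN N L, ∑ i : Fin N, ∑ j ∈ Finset.univ.erase i,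
            (∑' n : Fin 3 → ℤ, O.indicator (1 : Space → ℝ≥0∞) (X i - X j - latticeVec L n)) *
              (‖Ψ X‖₊ : ℝ≥0∞) ^ 2 := lintegral_mono hpt
      _ = ∑ i : Fin N, ∫⁻ X in cellN N L, ∑ j ∈ Finset.univ.erase i,
            (∑' n : Fin 3 → ℤ, O.indicator (1 : Space → ℝ≥0∞) (X i - X j - latticeVec L n)) *
              (‖Ψ X‖₊ : ℝ≥0∞) ^ 2 :=
          lintegral_finsetSum _ fun i _ ↦
            Finset.measurable_sum _ fun j _ ↦ (measurable_latSum_indicator L hOm i j).mul hf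
      _ = _ := Finset.sum_congr rfl fun i _ ↦
          lintegral_finsetSum _ fun j _ ↦ (measurable_latSum_indicator L hOm i j).mul hf
  -- (2) the bound for one ordered pair
  have h2 : ∀ i j : Fin N, i ≠ j →
      ∫⁻ X in cellN N L, (∑' n : Fin 3 → ℤ, O.indicator (1 : Space → ℝ≥0∞) (X i - X j - latticeVec L n)) *
          (‖Ψ X‖₊ : ℝ≥0∞) ^ 2 ≤ 16 * 𝓐 + 16 * ENNReal.ofReal (ℓ ^ 2) * 𝓑 := by
    intro i j hij
    have haℓ : 0 < a + ℓ := by linarith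
    have hc1 : a / (a + ℓ) ≤ 1 := (div_le_one haℓ).2 (by linarith)
    -- the fibrewise annulus estimate
    have hfib : ∀ X : Config N,
        ∫⁻ y in O, ((‖Ψ (Function.update X i (X j + y))‖₊ : ℝ≥0∞) ^ 2) ≤
          16 * (∫⁻ y in I, ((‖Ψ (Function.update X i (X j + y))‖₊ : ℝ≥0∞) ^ 2)) +
            16 * ENNReal.ofReal (ℓ ^ 2) *
              (∫⁻ y in F, kineticDensity Ψ (Function.update X i (X j + y))) := by
      intro X
      have hupd : Measurable fun y : Space ↦ Function.update X i (X j + y) :=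
        (measurable_update X).comp (measurable_const_add (X j))
      refine annulus_sq_le (Φ := fun y ↦ Ψ (Function.update X i (X j + y)))
        (kk := fun y ↦ kineticDensity Ψ (Function.update X i (X j + y)))
        (hΨ.continuous.measurable.comp hupd) (hkin.comp hupd) ha hℓ hℓa fun y ↦ ?_
      have key := nnnorm_sub_sq_le hΨ (Function.update X i (X j + (a / (a + ℓ)) • y)) i
        ((1 - a / (a + ℓ)) • y)
      have e1 : Function.update X i (X j + (a / (a + ℓ)) • y) + Pi.single i ((1 - a / (a + ℓ)) • y) =
          Function.update X i (X j + y) := by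
        rw [update_add_single, add_assoc, ← add_smul, add_sub_cancel, one_smul]
      have e2 : ∀ t : ℝ, Function.update X i (X j + (a / (a + ℓ)) • y) +
          t • (Pi.single i ((1 - a / (a + ℓ)) • y) : Config N) =
            Function.update X i (X j + (a / (a + ℓ) + t * (1 - a / (a + ℓ))) • y) := by
        intro t
        rw [← Pi.single_smul', update_add_single, smul_smul, add_assoc, ← add_smul]
      have e3 : ‖(1 - a / (a + ℓ)) • y‖ = (1 - a / (a + ℓ)) * ‖y‖ := by
        rw [norm_smul, Real.norm_eq_abs, abs_of_nonneg (by linarith)]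
      rw [e1, e3] at key
      simp only [e2] at key
      exact key
    have hP := pair_transfer hL hij hf hf hkin (fun X n ↦ by simp only [hΨlat])
      (fun X n ↦ by simp only [hΨlat]) (fun X n ↦ hKlat X i n) hOm hIm hFm 16
      (16 * ENNReal.ofReal (ℓ ^ 2)) hfib
    refine hP.trans (add_le_add ?_ ?_)
    · refine mul_le_mul_right ?_ _
      rw [h𝓐, ← Measure.restrict_restrict hSIm, ← lintegral_indicator hSIm]
      refine lintegral_mono fun X ↦ ?_
      have hwle : (∑' n : Fin 3 → ℤ, I.indicator (1 : Space → ℝ≥0∞) (X i - X j - latticeVec L n)) ≤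
          SI.indicator 1 X :=
        (tsum_indicator_sub_latticeVec_le (fun y hy ↦ hy.2) (by linarith) _).trans
          (indicator_one_le_indicator_one fun h ↦ ⟨i, j, hij, h⟩)
      calc (∑' n : Fin 3 → ℤ, I.indicator (1 : Space → ℝ≥0∞) (X i - X j - latticeVec L n)) *
            (‖Ψ X‖₊ : ℝ≥0∞) ^ 2 ≤ SI.indicator 1 X * (‖Ψ X‖₊ : ℝ≥0∞) ^ 2 := mul_le_mul_left hwle _
        _ = SI.indicator (fun X ↦ ((‖Ψ X‖₊ : ℝ≥0∞) ^ 2)) X := by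
            by_cases hX : X ∈ SI
            · simp only [Set.indicator_of_mem hX, Pi.one_apply, one_mul]
            · simp only [Set.indicator_of_notMem hX, zero_mul]
    · refine mul_le_mul_right ?_ _
      rw [h𝓑, ← Measure.restrict_restrict hSFm, ← lintegral_indicator hSFm]
      refine lintegral_mono fun X ↦ ?_
      have hwle : (∑' n : Fin 3 → ℤ, F.indicator (1 : Space → ℝ≥0∞) (X i - X j - latticeVec L n)) ≤
          SF.indicator 1 X :=
        (tsum_indicator_sub_latticeVec_le (fun y hy ↦ hy.2.le) (by linarith) _).trans
          (indicator_one_le_indicator_one fun h ↦ ⟨i, j, hij, h⟩)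
      calc (∑' n : Fin 3 → ℤ, F.indicator (1 : Space → ℝ≥0∞) (X i - X j - latticeVec L n)) *
            kineticDensity Ψ X ≤ SF.indicator 1 X * kineticDensity Ψ X := mul_le_mul_left hwle _
        _ = SF.indicator (kineticDensity Ψ) X := by
            by_cases hX : X ∈ SF
            · simp only [Set.indicator_of_mem hX, Pi.one_apply, one_mul]
            · simp only [Set.indicator_of_notMem hX, zero_mul]
  -- (3) sum over the ordered pairs
  have hC : ENNReal.ofReal ((16 * N ^ 2 : ℕ) : ℝ) = 16 * ((N : ℝ≥0∞) * N) := by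
    rw [ENNReal.ofReal_natCast]; push_cast; ring
  have hC' : ENNReal.ofReal (((16 * N ^ 2 : ℕ) : ℝ) * ℓ ^ 2) =
      16 * ((N : ℝ≥0∞) * N) * ENNReal.ofReal (ℓ ^ 2) := by
    rw [ENNReal.ofReal_mul (Nat.cast_nonneg _), hC]
  rw [hC, hC']
  calc ∫⁻ X in SO ∩ cellN N L, (‖Ψ X‖₊ : ℝ≥0∞) ^ 2
      ≤ ∑ i : Fin N, ∑ j ∈ Finset.univ.erase i, ∫⁻ X in cellN N L,
          (∑' n : Fin 3 → ℤ, O.indicator (1 : Space → ℝ≥0∞) (X i - X j - latticeVec L n)) *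
            (‖Ψ X‖₊ : ℝ≥0∞) ^ 2 := h1
    _ ≤ ∑ i : Fin N, ∑ j ∈ Finset.univ.erase i, (16 * 𝓐 + 16 * ENNReal.ofReal (ℓ ^ 2) * 𝓑) :=
        Finset.sum_le_sum fun i _ ↦ Finset.sum_le_sum fun j hj ↦ h2 i j (Finset.mem_erase.1 hj).1.symm
    _ ≤ ∑ i : Fin N, ∑ j : Fin N, (16 * 𝓐 + 16 * ENNReal.ofReal (ℓ ^ 2) * 𝓑) :=
        Finset.sum_le_sum fun i _ ↦ Finset.sum_le_sum_of_subset (Finset.erase_subset _ _)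
    _ = (N : ℝ≥0∞) * ((N : ℝ≥0∞) * (16 * 𝓐 + 16 * ENNReal.ofReal (ℓ ^ 2) * 𝓑)) := by
        simp only [Finset.sum_const, Finset.card_univ, Fintype.card_fin, nsmul_eq_mul]
    _ = 16 * ((N : ℝ≥0∞) * N) * 𝓐 + 16 * ((N : ℝ≥0∞) * N) * ENNReal.ofReal (ℓ ^ 2) * 𝓑 := by ring

end PairShellMass

open PairShellMass in
/-- **`stub_pairShellMassBoundV2`** (line `third-law-current-floor`, node P4 of the (α') plan; the
correctly parenthesised re-registration of `stub_pairShellMassBound`). For `N`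
particles on the torus of side `L > 4a` there is `C = C(N) ≥ 0` (`C = 16N²`) such that for every shell
width `0 < ℓ ≤ a` and every periodic `C¹` function `Ψ`, the mass in the OUTER pair shell
`{∃ i ≠ j ∃ n, a < |xᵢ - xⱼ - Ln| < a + ℓ}` is at most `C` times the mass in the INNER layer
`{a - ℓ < |xᵢ - xⱼ - Ln| ≤ a}` plus `C ℓ²` times the kinetic energy in the two-sided layer
`{a - ℓ < |xᵢ - xⱼ - Ln| < a + ℓ}` (all on the fundamental cell): unfold particle `i` of each ordered pair,
scale the pair variable by `c = a/(a+ℓ)` (first term) and apply the fundamental theorem of calculus along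
`[cy, y]` with Cauchy–Schwarz and Tonelli (second term), Jacobians `≤ 8`; sum over pairs using that
lattice translates of a ball of radius `2a < L/2` are disjoint. [folklore] -/
theorem stub_pairShellMassBoundV2 :
    ∀ (N : ℕ) (L a : ℝ), 0 < L → 0 < a → 4 * a < L → ∃ C : ℝ, 0 ≤ C ∧ ∀ ℓ : ℝ, 0 < ℓ → ℓ ≤ a →
      ∀ Ψ : Config N → ℂ, ContDiff ℝ 1 Ψ →
        (∀ (X : Config N) (i : Fin N) (k : Fin 3), Ψ (X + Pi.single i (EuclideanSpace.single k L)) = Ψ X) →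
        ∫⁻ X in {X : Config N | ∃ i j : Fin N, i ≠ j ∧ ∃ n : Fin 3 → ℤ,
            a < ‖X i - X j - latticeVec L n‖ ∧ ‖X i - X j - latticeVec L n‖ < a + ℓ} ∩ cellN N L,
            (‖Ψ X‖₊ : ℝ≥0∞) ^ 2 ≤
          ENNReal.ofReal C *
              (∫⁻ X in {X : Config N | ∃ i j : Fin N, i ≠ j ∧ ∃ n : Fin 3 → ℤ,
                  a - ℓ < ‖X i - X j - latticeVec L n‖ ∧ ‖X i - X j - latticeVec L n‖ ≤ a} ∩ cellN N L,
                  (‖Ψ X‖₊ : ℝ≥0∞) ^ 2) +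
            ENNReal.ofReal (C * ℓ ^ 2) *
              ∫⁻ X in {X : Config N | ∃ i j : Fin N, i ≠ j ∧ ∃ n : Fin 3 → ℤ,
                  a - ℓ < ‖X i - X j - latticeVec L n‖ ∧ ‖X i - X j - latticeVec L n‖ < a + ℓ} ∩ cellN N L,
                  kineticDensity Ψ X := by
  intro N L a hL ha h4a
  exact ⟨((16 * N ^ 2 : ℕ) : ℝ), Nat.cast_nonneg _, fun ℓ hℓ hℓa Ψ hΨ hper ↦
    shell_estimate hL ha h4a hℓ hℓa hΨ hper⟩

end Summit.AtomisticToContinuum.BoseEinsteinCondensation.Cruxes.HardCoreExtension.ThirdLawCurrentFloor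

end

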